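import Summits.QuantumFields.YangMills.Theorems.IsotropyFromPowerCountingTemperedCurvatureMomentsThreeSlotRegularityPart2
import Summits.QuantumFields.YangMills.Theorems.IsotropyFromPowerCountingTemperedCurvatureMomentsThreeSlotRegularityCutoff
import Summits.QuantumFields.YangMills.Theorems.IsotropyFromPowerCountingTemperedCurvatureMomentsThreeSlotRegularityNormControl
import Summits.QuantumFields.YangMills.Theorems.PencilRigidityCurvatureKernelBoundTensorRegularityFourier

/-!
# Three-slot regularity — stub `stub_threeSlotRegularity` (C) of crux `TemperedCurvatureMoments`

Stub C of reshape 4 of the registered skeleton `Cruxes/TemperedCurvatureMoments/Lines/Sketch.lean`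
(crux stmt-QuantumFields-17721, line `Sketch`), registered signature verbatim: the quantitative three-slot
form of the two-slot `CurvatureKernel.TensorRegularity` (Hörmander ALPDO I §8.1, "`WF(u) = ∅` forces `u` to be a
function", made quantitative).  Fix a Schwartz order `M₀`.  With `N₁ = 3M₀ + 13`, `q = 3(M₀ + N₁)` and ONE
constant `B₀`: for every assignment `D` of lattice directions to the three slots whose slot vectors together
with the four diagonal translations span `(ℝ⁴)³`, every `2ρ`-separated configuration `x`, `ρ ∈ (0,1]`, and
every continuous functional `Λ` on `𝓢((ℝ⁴)³)` that is translation invariant on `⁰𝒮` and obeys the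
pure-derivative slot bounds of order `≤ N₁` on `∏ B(xᵢ, ρ)`, the functional is, on `∏ B(xᵢ, ρ/2)`,
integration against a continuous kernel bounded by `B₀ ρ^{-q} (1 + ‖x‖)^q`.

Assembly (`Parts 1–4`: `…ThreeSlotRegularityPart1/Part2/Cutoff/NormControl`):
* cut-offs `χᵢ = χ_{xᵢ,ρ}` (`= 1` on `B(xᵢ, ρ/2)`, `supp ⊆ B(xᵢ, ρ)`) with
  `|(∂_t)^[m] χᵢ|_{M₀} ≤ ((1 + ‖xᵢ‖) ρ⁻¹)^{M₀+N₁} C₀` (`exists_scaled_cutoffs_le`);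
* the plane-wave values `g(a) = ‖Λ(⊗ᵢ e_{aᵢ} χᵢ)‖` decay like `|⟪a_k, t⟫|^{-N}` for `t ∈ D k`
  (`abs_inner_pow_mul_norm_tensorFin_le`, slot bounds) and like `|⟪Σᵢ aᵢ, e_μ⟫|^{-N}`
  (`abs_inner_sum_pow_mul_norm_tensorFin_le`, translation identity `Λ(∂_{(u,u,u)} ψ) = 0`), `N ≤ N₁`,
  at the cost `∏ᵢ (2π)^{M₀} (1 + ‖aᵢ‖)^{M₀} Sᵢ`;
* ONE constant `K` controls `‖Φa‖` by the best of these pairings for every admissible `D`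
  (`exists_uniform_normControl`, finiteness of the lattice menu), so `g(a) ≤ A (1 + ‖Φa‖)^{-13}` with
  `A = (3(1+K))^{N₁} (2π)^{3M₀} ∏ Sᵢ` (`pow_mul_le_of_decay`), integrable on `ℝ¹²`;
* `FourierDecayKernel` (`exists_kernel_of_planeWave_bound`) on the flattened space `ℝ¹²` (`flattenCLE 3 3`,
  measure preserving) gives the kernel, bounded by `∫ A (1 + ‖α‖)^{-13} dα ≤ B₀ ρ^{-q} (1 + ‖x‖)^q`.

HONEST LABEL: one registered pure-analysis stub of one line of crux T; registry progress only — T, the route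
`IsotropyFromPowerCounting` and the Yang–Mills mass gap remain open. [folklore]
-/

noncomputable section

namespace Summit.QuantumFields.YangMills.Theorems.TemperedCurvatureMoments.Sketch

open scoped BigOperators SchwartzMap ENNReal LineDeriv FourierTransform RealInnerProductSpace
open MeasureTheory Filter Topology
open Literature.MathematicalPhysics.QuantumFieldTheory Literature.MathematicalPhysics.QuantumLattice
open Literature.MathematicalPhysics.AQFT Literature.Analysis.FunctionSpaces
open Summit.QuantumFields.YangMills.Theorems.NPointIsotropy.Negative (E4)
open Summit.QuantumFields.YangMills.Theorems.CurvatureKernel (exists_kernel_of_planeWave_bound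
  smulLeftCLM_fourierChar_apply)

/-- **Stub C `stub_threeSlotRegularity` (pure analysis; Hörmander ALPDO I §8.1 made quantitative)** of
reshape 4 of the registered skeleton `Cruxes/TemperedCurvatureMoments/Lines/Sketch.lean`
(crux stmt-QuantumFields-17721), registered signature verbatim.  Fix a Schwartz order `M₀`.  There are
`N₁, q, B₀` such that for every assignment of lattice directions `D k` to the three slots whose slot
vectors `t ⊗ 1_k` together with the diagonal translations `e_μ ⊗ 1_{[3]}` span `(ℝ⁴)³`, every configuration
`x` and radius `ρ ∈ (0,1]` with `2ρ`-separated points, and every continuous functional `Λ` on `𝓢((ℝ⁴)³)`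
that is translation invariant on `⁰𝒮` and obeys the pure-derivative slot bounds
`‖Λ(f with slot k replaced by ∂_tᴺ f_k)‖ ≤ ∏ |fᵢ|_{M₀}` (`t ∈ D k`, `N ≤ N₁`, `supp fᵢ ⊆ B(xᵢ, ρ)`): on
`∏ B(xᵢ, ρ/2)` the functional is integration against a continuous kernel bounded by
`B₀ ρ^{-q} (1 + ‖x‖)^q`.  Proof: cut-offs `χᵢ` (`= 1` on `B(xᵢ,ρ/2)`, supported in `B(xᵢ,ρ)`, explicit
Schwartz bounds); the plane-wave values `Λ(⊗ e_{aᵢ}χᵢ)` decay like `|⟨a_k,t⟩|^{-N}` (slot bounds) and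
like `|⟨Σaᵢ,e_μ⟩|^{-N}` (translation identity `Λ(∂_Uψ) = 0`); spanning (with ONE norm-control constant
over the finite menu of admissible `D`) ⇒ `(1+‖a‖)^{-13}` decay; `FourierDecayKernel` on the flattened
`EuclideanSpace ℝ (Fin 3 × Fin 4)`. [folklore] -/
theorem stub_threeSlotRegularity :
    ∀ M₀ : ℕ, ∃ (N₁ q : ℕ) (B₀ : ℝ), ∀ (D : Fin 3 → Finset E4),
      (∀ k, ∀ t ∈ D k, (∃ n v : E4, ((∃ (μ ν : Fin 4) (s s' : ℝ), μ ≠ ν ∧ (s = 1 ∨ s = -1) ∧ (s' = 1 ∨ s' = -1) ∧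
            n = s • (EuclideanSpace.single μ (1 : ℝ) : E4) ∧ v = s' • (EuclideanSpace.single ν (1 : ℝ) : E4)) ∨
          (∃ (μ ν : Fin 4) (s s' : ℝ), μ ≠ ν ∧ (s = 1 ∨ s = -1) ∧ (s' = 1 ∨ s' = -1) ∧
            n = (Real.sqrt 2)⁻¹ • (s • (EuclideanSpace.single μ (1 : ℝ) : E4) + s' • (EuclideanSpace.single ν (1 : ℝ) : E4)) ∧
            v = (Real.sqrt 2)⁻¹ • (s • (EuclideanSpace.single μ (1 : ℝ) : E4) - s' • (EuclideanSpace.single ν (1 : ℝ) : E4)))) ∧ (t = n ∨ t = v))) →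
      (⊤ ≤ Submodule.span ℝ ((⋃ k : Fin 3, (fun t : E4 => (Pi.single k t : Fin 3 → E4)) '' (D k : Set E4)) ∪
          Set.range (fun μ : Fin 4 => fun _ : Fin 3 => (EuclideanSpace.single μ (1 : ℝ) : E4)))) →
      ∀ (x : Fin 3 → E4) (ρ : ℝ), 0 < ρ → ρ ≤ 1 → (∀ i j, i ≠ j → 2 * ρ < dist (x i) (x j)) →
      ∀ Λ : 𝓢((Fin 3 → E4), ℂ) →L[ℂ] ℂ,
        (∀ (a : E4) (F : 𝓢((Fin 3 → E4), ℂ)), IsOffDiagonal F → Λ (translateMulti a F) = Λ F) →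
        (∀ (k : Fin 3), ∀ t ∈ D k, ∀ N : ℕ, N ≤ N₁ → ∀ f : Fin 3 → 𝓢(E4, ℂ),
          (∀ i, tsupport (f i : E4 → ℂ) ⊆ Metric.ball (x i) ρ) → ∀ F : 𝓢((Fin 3 → E4), ℂ),
            IsTensorOf F (Function.update f k ((LineDeriv.lineDerivOp t : 𝓢(E4, ℂ) → 𝓢(E4, ℂ))^[N] (f k))) →
              ‖Λ F‖ ≤ ∏ i, schwartzNorm M₀ (f i)) →
        ∃ K₃ : (Fin 3 → E4) → ℂ, ContinuousOn K₃ {y | ∀ i, y i ∈ Metric.ball (x i) (ρ / 2)} ∧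
          (∀ y : Fin 3 → E4, (∀ i, y i ∈ Metric.ball (x i) (ρ / 2)) → ‖K₃ y‖ ≤ B₀ * ρ⁻¹ ^ q * (1 + ‖x‖) ^ q) ∧
          ∀ F : 𝓢((Fin 3 → E4), ℂ), tsupport (F : (Fin 3 → E4) → ℂ) ⊆ {y | ∀ i, y i ∈ Metric.ball (x i) (ρ / 2)} →
            Integrable (fun y => K₃ y * F y) ∧ Λ F = ∫ y, K₃ y * F y := by
  intro M₀
  -- the flattening `(ℝ⁴)³ ≃ ℝ¹²`
  set Φ : (Fin 3 → E4) ≃L[ℝ] EuclideanSpace ℝ (Fin 3 × Fin 4) := flattenCLE 3 3 with hΦ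
  -- constants, uniform over the admissible `D`, `x`, `ρ`, `Λ`
  obtain ⟨C₀, hC₀0, hC₀⟩ := ThreeSlotRegularity.exists_scaled_cutoffs_le (E := E4) M₀ (3 * M₀ + 13)
  obtain ⟨K, hK0, hK⟩ := ThreeSlotRegularity.exists_uniform_normControl
  obtain ⟨I, hI⟩ : ∃ I : ℝ, I = ∫ α : EuclideanSpace ℝ (Fin 3 × Fin 4), ((1 + ‖α‖) ^ 13)⁻¹ := ⟨_, rfl⟩
  have hI0 : 0 ≤ I := by rw [hI]; exact integral_nonneg fun α => by positivity
  refine ⟨3 * M₀ + 13, 3 * (M₀ + (3 * M₀ + 13)),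
    (3 * (1 + K)) ^ (3 * M₀ + 13) * ((2 * Real.pi) ^ (3 * M₀) * C₀ ^ 3) * I, ?_⟩
  intro D hD hspan x ρ hρ hρ1 hsep Λ hΛtr hΛ
  have hρi : 1 ≤ ρ⁻¹ := one_le_inv_iff₀.2 ⟨hρ, hρ1⟩
  -- the cut-offs `χᵢ`
  choose χ hχsupp hχone hχbd using fun i : Fin 3 => hC₀ (x i) ρ hρ hρ1
  obtain ⟨S, hS⟩ : ∃ S : Fin 3 → ℝ, ∀ i, S i = ((1 + ‖x i‖) * ρ⁻¹) ^ (M₀ + (3 * M₀ + 13)) * C₀ :=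
    ⟨_, fun i => rfl⟩
  have hS0 : ∀ i, 0 ≤ S i := fun i => by rw [hS]; positivity
  have hSle : ∀ i, S i ≤ ((1 + ‖x‖) * ρ⁻¹) ^ (M₀ + (3 * M₀ + 13)) * C₀ := by
    intro i
    have h1 : ‖x i‖ ≤ ‖x‖ := norm_le_pi_norm x i
    rw [hS]
    gcongr
  have hχS : ∀ (i : Fin 3) (t : E4), ‖t‖ ≤ 2 → ∀ m ≤ 3 * M₀ + 13,
      schwartzNorm M₀ (((∂_{t} : 𝓢(E4, ℂ) → 𝓢(E4, ℂ))^[m]) (χ i)) ≤ S i :=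
    fun i t ht m hm => by rw [hS]; exact hχbd i t ht m hm
  -- the slot bounds in tensor form
  have hslot : ∀ (k : Fin 3), ∀ t ∈ D k, ∀ N ≤ 3 * M₀ + 13, ∀ f : Fin 3 → 𝓢(E4, ℂ),
      (∀ i, tsupport (f i : E4 → ℂ) ⊆ Metric.ball (x i) ρ) →
      ‖Λ (SchwartzMap.tensorFin 3 (Function.update f k (((∂_{t} : 𝓢(E4, ℂ) → 𝓢(E4, ℂ))^[N]) (f k))))‖ ≤
        ∏ i, schwartzNorm M₀ (f i) :=
    fun k t ht N hN f hf => hΛ k t ht N hN f hf _ (isTensorOf_tensorFin _)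
  -- the order-zero bound (some slot is non-empty)
  obtain ⟨k₀, t₀, ht₀⟩ : ∃ k, ∃ t, t ∈ D k := by
    obtain ⟨k, hk⟩ := ThreeSlotRegularity.exists_nonempty_slot_of_top_le_span D hspan
    exact ⟨k, hk⟩
  have h0 : ∀ f : Fin 3 → 𝓢(E4, ℂ), (∀ i, tsupport (f i : E4 → ℂ) ⊆ Metric.ball (x i) ρ) →
      ‖Λ (SchwartzMap.tensorFin 3 f)‖ ≤ ∏ i, schwartzNorm M₀ (f i) := by
    intro f hf
    have h := hslot k₀ t₀ ht₀ 0 (Nat.zero_le _) f hf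
    simpa only [Function.iterate_zero, id_eq, Function.update_eq_self] using h
  -- translation invariance kills the diagonal derivatives
  have hvan : ∀ (u : E4) (f : Fin 3 → 𝓢(E4, ℂ)), (∀ i, tsupport (f i : E4 → ℂ) ⊆ Metric.ball (x i) ρ) →
      Λ (∂_{fun _ : Fin 3 => u} (SchwartzMap.tensorFin 3 f)) = 0 :=
    fun u f hf => ThreeSlotRegularity.apply_lineDerivOp_const_tensorFin_eq_zero Λ hΛtr x hsep u hf
  -- norms of the directions
  have hDnorm : ∀ k, ∀ t ∈ D k, ‖t‖ ≤ 2 := fun k t ht => ThreeSlotRegularity.norm_le_two_of_latticeFrame (hD k t ht)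
  have henorm : ∀ μ : Fin 4, ‖(EuclideanSpace.single μ (1 : ℝ) : E4)‖ ≤ 2 := fun μ => by
    have h : ‖(EuclideanSpace.single μ (1 : ℝ) : E4)‖ = 1 := by simp
    rw [h]; norm_num
  -- decay of the plane-wave values `g(a) = ‖Λ(⊗ e_{aᵢ} χᵢ)‖`
  have hdec_slot : ∀ (a : Fin 3 → E4) (k : Fin 3), ∀ t ∈ D k, ∀ N ≤ 3 * M₀ + 13,
      |⟪a k, t⟫| ^ N * ‖Λ (SchwartzMap.tensorFin 3 (fun i =>
        SchwartzMap.smulLeftCLM ℂ (fun y : E4 => (𝐞 (-⟪a i, y⟫) : ℂ)) (χ i)))‖ ≤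
      ∏ i, ((2 * Real.pi) ^ M₀ * (1 + ‖a i‖) ^ M₀ * S i) :=
    fun a k t ht N hN => ThreeSlotRegularity.abs_inner_pow_mul_norm_tensorFin_le Λ
      (U := fun i => Metric.ball (x i) ρ) (hslot k t ht) hχsupp (fun i m hm => hχS i t (hDnorm k t ht) m hm) a hN
  have hdec_tot : ∀ (a : Fin 3 → E4) (μ : Fin 4), ∀ N ≤ 3 * M₀ + 13,
      |⟪∑ i, a i, (EuclideanSpace.single μ (1 : ℝ) : E4)⟫| ^ N * ‖Λ (SchwartzMap.tensorFin 3 (fun i =>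
        SchwartzMap.smulLeftCLM ℂ (fun y : E4 => (𝐞 (-⟪a i, y⟫) : ℂ)) (χ i)))‖ ≤
      (3 : ℝ) ^ N * ∏ i, ((2 * Real.pi) ^ M₀ * (1 + ‖a i‖) ^ M₀ * S i) := by
    intro a μ N hN
    have h := ThreeSlotRegularity.abs_inner_sum_pow_mul_norm_tensorFin_le Λ (U := fun i => Metric.ball (x i) ρ)
      (EuclideanSpace.single μ (1 : ℝ) : E4) h0 (hvan _) hχsupp (fun i m hm => hχS i _ (henorm μ) m hm) a hN
    exact_mod_cast h
  -- the growth constant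
  obtain ⟨Dc, hDc⟩ : ∃ Dc : ℝ, Dc = (2 * Real.pi) ^ (3 * M₀) * ∏ i, S i := ⟨_, rfl⟩
  have hDc0 : 0 ≤ Dc := by rw [hDc]; exact mul_nonneg (by positivity) (Finset.prod_nonneg fun i _ => hS0 i)
  have hprod : ∀ a : Fin 3 → E4, ∏ i, ((2 * Real.pi) ^ M₀ * (1 + ‖a i‖) ^ M₀ * S i) ≤
      Dc * (1 + ‖Φ a‖) ^ (3 * M₀) := by
    intro a
    have hle : ∀ i, (2 * Real.pi) ^ M₀ * (1 + ‖a i‖) ^ M₀ * S i ≤ (2 * Real.pi) ^ M₀ * (1 + ‖Φ a‖) ^ M₀ * S i := by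
      intro i
      have h1 : ‖a i‖ ≤ ‖Φ a‖ := ThreeSlotRegularity.norm_apply_le_norm_flattenCLE a i
      have h2 := hS0 i
      gcongr
    calc ∏ i, ((2 * Real.pi) ^ M₀ * (1 + ‖a i‖) ^ M₀ * S i)
        ≤ ∏ i, ((2 * Real.pi) ^ M₀ * (1 + ‖Φ a‖) ^ M₀ * S i) :=
          Finset.prod_le_prod (fun i _ => by have := hS0 i; positivity) (fun i _ => hle i)
      _ = Dc * (1 + ‖Φ a‖) ^ (3 * M₀) := by
          rw [Finset.prod_mul_distrib, Finset.prod_const, Finset.card_univ, Fintype.card_fin, hDc]; ring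
  -- the integrable majorant on `ℝ¹²`
  obtain ⟨A, hA⟩ : ∃ A : ℝ, A = (3 * (1 + K)) ^ (3 * M₀ + 13) * Dc := ⟨_, rfl⟩
  have hA0 : 0 ≤ A := by rw [hA]; exact mul_nonneg (by positivity) hDc0
  obtain ⟨b, hb⟩ : ∃ b : EuclideanSpace ℝ (Fin 3 × Fin 4) → ℝ, b = fun α => A * ((1 + ‖α‖) ^ 13)⁻¹ := ⟨_, rfl⟩
  have hbi : Integrable b := by
    have h13 : (Module.finrank ℝ (EuclideanSpace ℝ (Fin 3 × Fin 4)) : ℝ) < 13 := by simp; norm_num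
    have h := (integrable_one_add_norm (μ := (volume : Measure (EuclideanSpace ℝ (Fin 3 × Fin 4)))) h13).const_mul A
    rw [hb]
    refine h.congr (Eventually.of_forall fun α => ?_)
    show A * (1 + ‖α‖) ^ (-(13 : ℝ)) = A * ((1 + ‖α‖) ^ 13)⁻¹
    rw [Real.rpow_neg (by positivity), show (13 : ℝ) = ((13 : ℕ) : ℝ) by norm_num, Real.rpow_natCast]
  -- the functional and the cut-off on the flattened space
  obtain ⟨T, hT⟩ : ∃ T : 𝓢(EuclideanSpace ℝ (Fin 3 × Fin 4), ℂ) →L[ℂ] ℂ,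
      T = Λ.comp (SchwartzMap.compCLMOfContinuousLinearEquiv ℂ Φ) := ⟨_, rfl⟩
  obtain ⟨χ', hχ'⟩ : ∃ χ' : 𝓢(EuclideanSpace ℝ (Fin 3 × Fin 4), ℂ),
      χ' = SchwartzMap.compCLMOfContinuousLinearEquiv ℂ Φ.symm (SchwartzMap.tensorFin 3 χ) := ⟨_, rfl⟩
  have hχ'x : ∀ y : Fin 3 → E4, χ' (Φ y) = ∏ i, χ i (y i) := fun y => by
    rw [hχ', SchwartzMap.compCLMOfContinuousLinearEquiv_apply, Function.comp_apply, Φ.symm_apply_apply,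
      SchwartzMap.tensorFin_apply]
  -- decay of the plane-wave values of `χ'T`
  have hdecay : ∀ (α : EuclideanSpace ℝ (Fin 3 × Fin 4)) (ψ : 𝓢(EuclideanSpace ℝ (Fin 3 × Fin 4), ℂ)),
      (∀ p, ψ p = (𝐞 (-⟪α, p⟫) : ℂ) * χ' p) → ‖T ψ‖ ≤ b α := by
    intro α ψ hψ
    obtain ⟨a, ha⟩ : ∃ a : Fin 3 → E4, a = Φ.symm α := ⟨_, rfl⟩
    have hαa : Φ a = α := by rw [ha]; exact Φ.apply_symm_apply α
    have hTψ : T ψ = Λ (SchwartzMap.tensorFin 3 (fun i =>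
        SchwartzMap.smulLeftCLM ℂ (fun y : E4 => (𝐞 (-⟪a i, y⟫) : ℂ)) (χ i))) := by
      rw [hT, ContinuousLinearMap.comp_apply]
      congr 1
      ext y
      have hin : ⟪α, Φ y⟫ = ∑ i, ⟪a i, y i⟫ := by rw [← hαa, hΦ, ThreeSlotRegularity.inner_flattenCLE]
      rw [SchwartzMap.compCLMOfContinuousLinearEquiv_apply, Function.comp_apply, hψ, hχ'x,
        SchwartzMap.tensorFin_apply, hin]
      simp only [smulLeftCLM_fourierChar_apply]
      rw [Fin.sum_univ_three, Fin.prod_univ_three, Fin.prod_univ_three, neg_add, neg_add,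
        AddChar.map_add_eq_mul, AddChar.map_add_eq_mul, Circle.coe_mul, Circle.coe_mul]
      ring
    obtain ⟨g, hg⟩ : ∃ g : ℝ, g = ‖Λ (SchwartzMap.tensorFin 3 (fun i =>
        SchwartzMap.smulLeftCLM ℂ (fun y : E4 => (𝐞 (-⟪a i, y⟫) : ℂ)) (χ i)))‖ := ⟨_, rfl⟩
    have hg0 : 0 ≤ g := by rw [hg]; exact norm_nonneg _
    have hs1 : 1 ≤ 1 + ‖α‖ := by linarith [norm_nonneg α]
    have hprod' : ∏ i, ((2 * Real.pi) ^ M₀ * (1 + ‖a i‖) ^ M₀ * S i) ≤ Dc * (1 + ‖α‖) ^ (3 * M₀) := by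
      have := hprod a; rwa [hαa] at this
    -- the controlling generator
    have hgen : ∃ p : ℝ, 0 ≤ p ∧ ‖α‖ ≤ K * p ∧
        ∀ N ≤ 3 * M₀ + 13, p ^ N * g ≤ 3 ^ N * (Dc * (1 + ‖α‖) ^ (3 * M₀)) := by
      rcases hK D hD hspan a with ⟨k, t, ht, hle⟩ | ⟨μ, hle⟩
      · refine ⟨|⟪a k, t⟫|, abs_nonneg _, by rwa [← hΦ, hαa] at hle, fun N hN => ?_⟩
        calc |⟪a k, t⟫| ^ N * g ≤ ∏ i, ((2 * Real.pi) ^ M₀ * (1 + ‖a i‖) ^ M₀ * S i) := by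
              rw [hg]; exact hdec_slot a k t ht N hN
          _ ≤ Dc * (1 + ‖α‖) ^ (3 * M₀) := hprod'
          _ ≤ 3 ^ N * (Dc * (1 + ‖α‖) ^ (3 * M₀)) :=
              le_mul_of_one_le_left (by positivity) (one_le_pow₀ (by norm_num))
      · refine ⟨|⟪∑ i, a i, (EuclideanSpace.single μ (1 : ℝ) : E4)⟫|, abs_nonneg _, by rwa [← hΦ, hαa] at hle,
          fun N hN => ?_⟩
        calc |⟪∑ i, a i, (EuclideanSpace.single μ (1 : ℝ) : E4)⟫| ^ N * g
            ≤ (3 : ℝ) ^ N * ∏ i, ((2 * Real.pi) ^ M₀ * (1 + ‖a i‖) ^ M₀ * S i) := by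
              rw [hg]; exact hdec_tot a μ N hN
          _ ≤ 3 ^ N * (Dc * (1 + ‖α‖) ^ (3 * M₀)) := mul_le_mul_of_nonneg_left hprod' (by positivity)
    obtain ⟨p, -, hαp, hpN⟩ := hgen
    have hcomb := ThreeSlotRegularity.pow_mul_le_of_decay (P := 3 * M₀) (k := 13) hK0 hg0 hDc0 hs1
      (by linarith) hpN
    rw [hb]
    change ‖T ψ‖ ≤ A * ((1 + ‖α‖) ^ 13)⁻¹
    rw [hTψ, ← hg, ← div_eq_mul_inv, le_div_iff₀ (by positivity), mul_comm, hA]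
    exact hcomb
  -- the kernel on the flattened space
  obtain ⟨K', hK'c, hK'b, hK'rep⟩ := exists_kernel_of_planeWave_bound T χ' hbi hdecay
  -- the bound `∫ b ≤ B₀ ρ^{-q} (1 + ‖x‖)^q`
  have hIb : ∫ α, b α = A * I := by
    rw [hb, hI]
    exact integral_const_mul _ _
  have hprodS : ∏ i, S i ≤ (1 + ‖x‖) ^ (3 * (M₀ + (3 * M₀ + 13))) * ρ⁻¹ ^ (3 * (M₀ + (3 * M₀ + 13))) * C₀ ^ 3 := by
    calc ∏ i, S i ≤ ∏ _i : Fin 3, (((1 + ‖x‖) * ρ⁻¹) ^ (M₀ + (3 * M₀ + 13)) * C₀) :=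
          Finset.prod_le_prod (fun i _ => hS0 i) (fun i _ => hSle i)
      _ = (1 + ‖x‖) ^ (3 * (M₀ + (3 * M₀ + 13))) * ρ⁻¹ ^ (3 * (M₀ + (3 * M₀ + 13))) * C₀ ^ 3 := by
          rw [Finset.prod_const, Finset.card_univ, Fintype.card_fin,
            mul_pow (((1 + ‖x‖) * ρ⁻¹) ^ (M₀ + (3 * M₀ + 13))) C₀ 3,
            ← pow_mul' ((1 + ‖x‖) * ρ⁻¹) 3 (M₀ + (3 * M₀ + 13)), mul_pow (1 + ‖x‖) ρ⁻¹]
  have hAI : A * I ≤ (3 * (1 + K)) ^ (3 * M₀ + 13) * ((2 * Real.pi) ^ (3 * M₀) * C₀ ^ 3) * I *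
      ρ⁻¹ ^ (3 * (M₀ + (3 * M₀ + 13))) * (1 + ‖x‖) ^ (3 * (M₀ + (3 * M₀ + 13))) := by
    rw [hA, hDc]
    have hXq : 0 ≤ (1 + ‖x‖) ^ (3 * (M₀ + (3 * M₀ + 13))) := by positivity
    have hRq : 0 ≤ ρ⁻¹ ^ (3 * (M₀ + (3 * M₀ + 13))) := by positivity
    have h1 := hprodS
    generalize (1 + ‖x‖) ^ (3 * (M₀ + (3 * M₀ + 13))) = Xq at hXq h1 ⊢
    generalize ρ⁻¹ ^ (3 * (M₀ + (3 * M₀ + 13))) = Rq at hRq h1 ⊢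
    have hP0 : 0 ≤ ∏ i, S i := Finset.prod_nonneg fun i _ => hS0 i
    calc (3 * (1 + K)) ^ (3 * M₀ + 13) * ((2 * Real.pi) ^ (3 * M₀) * ∏ i, S i) * I
        ≤ (3 * (1 + K)) ^ (3 * M₀ + 13) * ((2 * Real.pi) ^ (3 * M₀) * (Xq * Rq * C₀ ^ 3)) * I := by
          gcongr
      _ = _ := by ring
  refine ⟨fun y => K' (Φ y), (hK'c.comp Φ.continuous).continuousOn,
    fun y _ => (hK'b (Φ y)).trans (by rw [hIb]; exact hAI), fun F hF => ?_⟩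
  -- representation for `F` supported in `∏ B(xᵢ, ρ/2)`
  obtain ⟨G, hG⟩ : ∃ G : 𝓢(EuclideanSpace ℝ (Fin 3 × Fin 4), ℂ),
      G = SchwartzMap.compCLMOfContinuousLinearEquiv ℂ Φ.symm F := ⟨_, rfl⟩
  have hFG : F = SchwartzMap.compCLMOfContinuousLinearEquiv ℂ Φ
      (SchwartzMap.smulLeftCLM ℂ (χ' : EuclideanSpace ℝ (Fin 3 × Fin 4) → ℂ) G) := by
    ext y
    rw [SchwartzMap.compCLMOfContinuousLinearEquiv_apply, Function.comp_apply,
      SchwartzMap.smulLeftCLM_apply_apply χ'.hasTemperateGrowth, smul_eq_mul, hχ'x, hG,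
      SchwartzMap.compCLMOfContinuousLinearEquiv_apply, Function.comp_apply, Φ.symm_apply_apply]
    by_cases hy : y ∈ tsupport (F : (Fin 3 → E4) → ℂ)
    · have h1 : ∏ i, χ i (y i) = 1 := Finset.prod_eq_one fun i _ => hχone i (y i) (hF hy i)
      rw [h1, one_mul]
    · rw [image_eq_zero_of_notMem_tsupport hy, mul_zero]
  obtain ⟨hint, hrep⟩ := hK'rep G
  have hΛF : Λ F = T (SchwartzMap.smulLeftCLM ℂ (χ' : EuclideanSpace ℝ (Fin 3 × Fin 4) → ℂ) G) := by
    rw [hT, ContinuousLinearMap.comp_apply, ← hFG]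
  have hcov : ∫ y : Fin 3 → E4, K' (Φ y) * F y = ∫ p, K' p * G p := by
    have h := integral_comp_flattenCLE (d := 3) (n := 3) (fun p => K' p * G p)
    refine Eq.trans (integral_congr_ae (Eventually.of_forall fun y => ?_)) h
    simp only [hG, SchwartzMap.compCLMOfContinuousLinearEquiv_apply, Function.comp_apply, hΦ,
      ContinuousLinearEquiv.symm_apply_apply]
  refine ⟨?_, ?_⟩
  · haveI : (volume : Measure (Fin 3 → E4)).HasTemperateGrowth := Measure.IsAddHaarMeasure.instHasTemperateGrowth
    exact F.integrable.bdd_mul (hK'c.comp Φ.continuous).aestronglyMeasurable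
      (Eventually.of_forall fun y => hK'b (Φ y))
  · rw [hΛF, hrep, hcov]

end Summit.QuantumFields.YangMills.Theorems.TemperedCurvatureMoments.Sketch

end
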